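import Mathlib

/-!
# FM-door residue: unit shears, the nef-CE₄ reading, and the PALINDROME LAW — kernel leg (hsemireg-alphabet-isogeny-1 g9)

EVIDENCE for the LINE `stmt-HodgeConjecture-18881 Cruxes/BlochSeedDiscOne/Lines/birth.lean 814a6a70c14e831a
stub_rung_pad4_seedAt`, not a rung.  Nothing here is proved toward HC ∕ HC_CM ∕ HC_AV ∕ №4 ∕ 26512 ∕ 18881 ∕ H2.
Mathlib-only; no `sorry`, no `instance`, no `notation`, no `allowUnsafeReducibility`.

Memo of record: `run/shared/lean/pub/pub-hsemireg/hsemireg-alphabet-isogeny-1/SPEC-ISOGENY-ALPHABET-isogeny1-g9.md`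
(«FM DOOR ⊆ NEF-CE₄ and the PALINDROME LAW for unimodular CE₄»).  This file kernel-checks the elementary arithmetic the
memo leans on; the sheaf-level dictionary (Mukai base change for `ι : D ↪ P`, GRR for `ι_* (L_y|_D)`), the Jacobi ∕ (M3)
complementary-minor bookkeeping and the apolarity lemma are pencil in the memo and exact-engine-tested (`code/fmresidue.py`,
`data/g9/fmresidue.log`); the integer census is `code/palcensus.c` + `data/g9/palcensus_*.log`.

* §1 GAP LEMMA arithmetic (memo §1): for a pair `(y, y + d)`, `gap = g₁ + ⋯ + g_m` (`m = rank d`) with every `g_j` a positive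
  integer and `g₁ = tr(adj(y) d) ≥ m` (AM–GM: `amgm_two` is the `m = 2` step), hence `gap ≥ 2m − 1` (`gap_ge_of_parts`) and a
  pair of gap `≤ 2` is a UNIT SHEAR, `m = 1` (`unit_shear_of_budget`).  This sharpens g8 §2.2 (`gap ≥ rank d`).
* §2 NEWTON CLOSURE in the clean algebra (memo §3): `e₂ e₃ e₄` and the closed power sums `N5 … N8` of four formal roots from
  `λ₁ … λ₄`; the scalar design `λ ≡ 4` is a fixed point with defect `0` (`scalar_fixed`); the defect `c = 4 − N8` is
  `|μ|²∕140` by (R4) (kernel of record `StrengthenRank4Closure`, not re-proved here).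
* §3 ARITHMETIC FLOORS (memo §4): PROP F downstairs (`WeilLatticeLaw.normSq_floor`: `|μ|² ∈ 15680·ℕ`) ⇒ the defect lies in
  `112ℤ` (`defect_mem_112`); the nef Cauchy–Schwarz step `|μ| ≤ Σ mₐ √(xₐ yₐ) ≤ τ₄` (`sqrt_mul_le_half`, `weil_le_tau4`);
  together `τ₄ ≥ 126` (`tau4_ge_126`) and, through the Maclaurin box `τ₄ ≤ (τ₁ − 3)⁴ + 3` of four unimodular positive
  letters, `τ₁ ≥ 7` (`tau1_ge_7`).
-/

namespace HsemiregIsogeny1.FMDoorResidue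

/-! ## §1 Gap lemma arithmetic -/

/-- AM–GM step behind `g₁ = tr(adj y · d) ≥ rank d` for `rank d = 2`: two positive reals with product `≥ 1` sum to `≥ 2`. -/
theorem amgm_two (n₁ n₂ : ℝ) (h1 : 0 < n₁) (h2 : 0 < n₂) (h : 1 ≤ n₁ * n₂) : 2 ≤ n₁ + n₂ := by
  nlinarith [sq_nonneg (n₁ - n₂), sq_nonneg (n₁ + n₂ - 2)]

/-- `gap = g₁ + (g₂ + ⋯ + g_m)` with `g₁ ≥ m` and the other `m − 1` parts `≥ 1` each gives `gap ≥ 2m − 1`. -/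
theorem gap_ge_of_parts (m : ℕ) (g₁ rest : ℤ) (h1 : (m : ℤ) ≤ g₁) (hrest : (m : ℤ) - 1 ≤ rest) :
    2 * (m : ℤ) - 1 ≤ g₁ + rest := by omega

/-- the `m − 1` higher parts: a sum of `k` integers each `≥ 1` is `≥ k`. -/
theorem sum_ge_card (k : ℕ) (g : Fin k → ℤ) (hg : ∀ j, 1 ≤ g j) : (k : ℤ) ≤ ∑ j, g j := by
  calc (k : ℤ) = ∑ _j : Fin k, (1 : ℤ) := by simp
    _ ≤ ∑ j, g j := Finset.sum_le_sum fun j _ => hg j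

/-- UNIT SHEARS: the χ-budget leaves every pair a gap `≤ 2`; with `gap ≥ 2m − 1` the increment has rank `m = 1`. -/
theorem unit_shear_of_budget (m gap : ℕ) (hm : 1 ≤ m) (hgap : 2 * m - 1 ≤ gap) (hb : gap ≤ 2) : m = 1 := by omega

/-- and then `gap = c·g` with `c, g ≥ 1`, `c·g ≤ 2`: the three unit-shear types `(c,g) ∈ {(1,1),(1,2),(2,1)}`. -/
theorem unit_shear_types (c g : ℕ) (hc : 1 ≤ c) (hg : 1 ≤ g) (h : c * g ≤ 2) :
    (c = 1 ∧ g = 1) ∨ (c = 1 ∧ g = 2) ∨ (c = 2 ∧ g = 1) := by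
  have hc2 : c ≤ 2 := by nlinarith
  have hg2 : g ≤ 2 := by nlinarith
  interval_cases c <;> interval_cases g <;> simp_all

/-! ## §2 Newton closure of four formal roots (clean algebra, exact over `ℚ`) -/

/-- elementary symmetric functions of four formal roots from the power sums `a = λ₁, b = λ₂, q = λ₃, m = λ₄`. -/
def e2 (a b : ℚ) : ℚ := (a ^ 2 - b) / 2
/-- `e₃`. -/
def e3 (a b q : ℚ) : ℚ := (a ^ 3 - 3 * a * b + 2 * q) / 6
/-- `e₄`. -/
def e4 (a b q m : ℚ) : ℚ := (a ^ 4 - 6 * a ^ 2 * b + 3 * b ^ 2 + 8 * a * q - 6 * m) / 24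

/-- closed power sums `p₅ … p₈` of the four formal roots (Newton: `p_d = e₁p_{d−1} − e₂p_{d−2} + e₃p_{d−3} − e₄p_{d−4}`). -/
def N5 (a b q m : ℚ) : ℚ := a * m - e2 a b * q + e3 a b q * b - e4 a b q m * a
/-- `p₆`. -/
def N6 (a b q m : ℚ) : ℚ := a * N5 a b q m - e2 a b * m + e3 a b q * q - e4 a b q m * b
/-- `p₇`. -/
def N7 (a b q m : ℚ) : ℚ := a * N6 a b q m - e2 a b * N5 a b q m + e3 a b q * m - e4 a b q m * q
/-- `p₈`; by (R4) the clean class of a rank-4 bundle has `λ₈ = N8 + |μ|²∕140` (STRENGTHEN-MEMO-06, kernel `StrengthenRank4Closure`). -/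
def N8 (a b q m : ℚ) : ℚ := a * N7 a b q m - e2 a b * N6 a b q m + e3 a b q * N5 a b q m - e4 a b q m * m

/-- the DEFECT of a clean sequence with `λ₈ = r`: `c = r − N8(λ₁,…,λ₄)` (`= |μ|²∕140` for a rank-4 bundle of Euler characteristic `r`). -/
def defect (r a b q m : ℚ) : ℚ := r - N8 a b q m

/-- the scalar design (four copies of the principal letter, `λ_d = 4` for all `d`) is a fixed point of the closure with defect `0`:
the base point of the principal real curve 𝒞 of the memo (§3.4). -/
theorem scalar_fixed : N5 4 4 4 4 = 4 ∧ N6 4 4 4 4 = 4 ∧ N7 4 4 4 4 = 4 ∧ N8 4 4 4 4 = 4 ∧ defect 4 4 4 4 4 = 0 := by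
  norm_num [N5, N6, N7, N8, defect, e2, e3, e4]

/-- formal roots `(1,1,1,−1)`: power sums `λ_d = 3 + (−1)^d`, an eighth-roots-of-unity solution of the two-sided closure with
defect `0` (memo §3.3: the `c = 0` family `s ∈ μ₈⁴`). -/
theorem mu8_point : N5 2 4 2 4 = 2 ∧ N6 2 4 2 4 = 4 ∧ N7 2 4 2 4 = 2 ∧ N8 2 4 2 4 = 4 := by
  norm_num [N5, N6, N7, N8, e2, e3, e4]

/-- `24·e₄` is the integer form `d4` of `WeilLatticeLaw` (same polynomial); recorded so the APOLARITY LEMMA of the memo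
(`μ ≠ 0 ⇒ d4(λ₁,λ₂,λ₃,λ₄) = d4(λ₇,λ₆,λ₅,λ₄)` for unimodular CE₄) reads on existing names. -/
theorem e4_eq_d4_div (a b q m : ℚ) :
    24 * e4 a b q m = a ^ 4 - 6 * a ^ 2 * b + 3 * b ^ 2 + 8 * a * q - 6 * m := by
  unfold e4; ring

/-! ## §3 Arithmetic floors: PROP F downstairs, nef Cauchy–Schwarz, `τ₄ ≥ 126`, `τ₁ ≥ 7` -/

/-- PROP F (`|μ|² ∈ 15680ℤ`, WeilLatticeLaw) read on the defect `c = |μ|²∕140`: `c ∈ 112ℤ`. -/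
theorem defect_mem_112 (N c : ℤ) (hN : N = 140 * c) (hF : (15680 : ℤ) ∣ N) : (112 : ℤ) ∣ c := by
  subst hN; omega

/-- Cauchy–Schwarz ∕ AM–GM step for one nef letter: `√(x y) ≤ (x + y)∕2` for `x, y ≥ 0`
(`x = det Q[Z,Z]`, `y = det Q[Z′,Z′]`, `|det Q[Z,Z′]| ≤ √(x y)` for psd `Q`). -/
theorem sqrt_mul_le_half (x y : ℝ) (hx : 0 ≤ x) (hy : 0 ≤ y) : Real.sqrt (x * y) ≤ (x + y) / 2 := by
  rw [show x * y = Real.sqrt x ^ 2 * Real.sqrt y ^ 2 by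
        rw [Real.sq_sqrt hx, Real.sq_sqrt hy]]
  rw [show Real.sqrt x ^ 2 * Real.sqrt y ^ 2 = (Real.sqrt x * Real.sqrt y) ^ 2 by ring]
  rw [Real.sqrt_sq (mul_nonneg (Real.sqrt_nonneg x) (Real.sqrt_nonneg y))]
  nlinarith [sq_nonneg (Real.sqrt x - Real.sqrt y), Real.sq_sqrt hx, Real.sq_sqrt hy,
    Real.sqrt_nonneg x, Real.sqrt_nonneg y]

/-- NEF CAUCHY–SCHWARZ for a clean four-letter nef class (multiplicities `mₐ ≥ 0`): if `|μ| ≤ Σ mₐ √(xₐ yₐ)` and the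
principal order-4 rows are clean, `Σ mₐ xₐ = Σ mₐ yₐ = τ₄`, then `|μ| ≤ τ₄`. -/
theorem weil_le_tau4 (μabs τ : ℝ) (mult x y : Fin 4 → ℝ) (hm : ∀ a, 0 ≤ mult a) (hx : ∀ a, 0 ≤ x a)
    (hy : ∀ a, 0 ≤ y a) (hμ : μabs ≤ ∑ a, mult a * Real.sqrt (x a * y a))
    (hX : ∑ a, mult a * x a = τ) (hY : ∑ a, mult a * y a = τ) : μabs ≤ τ := by
  have key : ∑ a, mult a * Real.sqrt (x a * y a) ≤ ∑ a, mult a * ((x a + y a) / 2) :=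
    Finset.sum_le_sum fun a _ => mul_le_mul_of_nonneg_left (sqrt_mul_le_half _ _ (hx a) (hy a)) (hm a)
  have split : ∑ a, mult a * ((x a + y a) / 2) = (∑ a, mult a * x a + ∑ a, mult a * y a) / 2 := by
    rw [← Finset.sum_add_distrib, Finset.sum_div]
    exact Finset.sum_congr rfl fun a _ => by ring
  linarith [key, split.le, split.ge]

/-- `τ₄ ≥ 126`: a non-zero defect in `112ℤ` and the Cauchy–Schwarz bound `|μ|² = 140c ≤ τ₄²` force `τ₄ ≥ 126`. -/
theorem tau4_ge_126 (c m : ℤ) (hc : (112 : ℤ) ∣ c) (hc1 : 1 ≤ c) (hm : 0 ≤ m) (hcs : 140 * c ≤ m ^ 2) : 126 ≤ m := by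
  obtain ⟨k, rfl⟩ := hc
  have hk : 1 ≤ k := by omega
  nlinarith

/-- `τ₁ ≥ 7` for shape (δ): four unimodular positive letters have `τ₄ ≤ (τ₁ − 3)⁴ + 3` (Maclaurin per letter,
`E₄ ≤ E₁⁴`, `E₁ ≥ 1`), so `τ₄ ≥ 126` needs `τ₁ ≥ 7`. -/
theorem tau1_ge_7 (a : ℕ) (ha : 4 ≤ a) (h : 126 ≤ (a - 3) ^ 4 + 3) : 7 ≤ a := by
  by_contra hlt
  have : a = 4 ∨ a = 5 ∨ a = 6 := by omega
  rcases this with rfl | rfl | rfl <;> simp_all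

/-- the same floor read downstairs for every residue shape: with `E₁ ≥ 3∕4` for each of the three other letters one has
`τ̂₄ ≤ (τ̂₁ − 9∕4)⁴ + 3`, so `τ̂₄ ≥ 126` needs `τ̂₁ ≥ 6` (`(6 − 1 − 9∕4)⁴ + 3 < 126`). -/
theorem tauhat1_ge_6 (t : ℕ) (h : (126 : ℚ) ≤ ((t : ℚ) - 9 / 4) ^ 4 + 3) (ht : 3 ≤ t) : 6 ≤ t := by
  by_contra hlt
  have : t = 3 ∨ t = 4 ∨ t = 5 := by omega
  rcases this with rfl | rfl | rfl <;> norm_num at h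

end HsemiregIsogeny1.FMDoorResidue
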